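import Mathlib
import Summits.NavierStokesRegularity.NavierStokesRegularity.Theorems.WakeRatchetAdmissibleEternalBoundDyadic
import HarnessLib

/-!
# Admissible eternal solutions of STRONG-ORTHANT (pure Katz–Pavlović network) tables are componentwise
# NON-NEGATIVE (support for `WakeRatchet.AdmissibleEternalBound`, stmt-NavierStokesRegularity-23197)

The crux `AdmissibleEternalBound` asks that every admissible eternal solution (`IsEternalVisc ε₀ ν̂ α W`:
renormalised lattice law with covariant viscosity `ν̂ ≥ 0`, UNIFORM per-shell action `∫‖W_n‖ ≤ M`,
per-shell forward energy bound) of an E₂(R) table be `UniformBound`.  It is refuted MODULO open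
constructions on SIGN-MIXING tables (`Negative/…FalseOfSymmetricDSSWaves`, `…FalseOfGlobalSelfSimilarProfiles`)
and PROVED on slices (inviscid forward cascades, `WakeRatchetPersistence.uniformBound_of_forwardCascade`;
the dyadic member, `WakeRatchetDyadic.uniformBound_dyadic` via `dyadic_nonneg`).  This file is the first
half of the extension of the positive slice from the one-mode dyadic member to the whole STRONG-ORTHANT
class (the companion `WakeRatchetAdmissibleEternalBoundOrthantBound` draws the consequences:
forward fluxes, `UniformBound` inviscidly, the `quadTerm` form of the hypothesis, the dyadic instance).

THE HYPOTHESIS AT A MODE `i` (strong quasi-positivity = the UNCONDITIONAL Kamke condition at `i`):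
(a) the feed form into `i` is non-negative on all of `ℝ^m`, `(A y)_i ≥ 0`; (b) the in-shell form into
`i` is non-negative on the hyperplane `{x_i = 0}`; (c) the back-reaction on `i` is diagonal,
`(B(z,x))_i = 0` whenever `x_i = 0`.  No sign assumption on the other modes or shells.  Satisfied by
every mode of a pure Katz–Pavlović network (square feeds `x_s² → y_t` with the energy-conserving damping
`−x_s y_t`; pump gates `(Q x)_t = q x_s²`, `(Q x)_s = −q x_s x_t`), e.g. `dyadicTable`; violated by
differential feeds, cross back-reactions, rotor gates and every sign-mixing table.

RESULT `apply_nonneg`: for every admissible eternal solution (any `ε₀ > 0`, any `ν̂ ≥ 0`, any table on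
any number of modes) and every strongly quasi-positive mode `i`, `W_{n,i}(σ) ≥ 0` at every shell
`n ∈ ℤ` and log-time `σ`.  Positivity is forced by ADMISSIBILITY (there is no datum; compare the routes'
forward-invariance statement `OrthantInvariance`).

MECHANISM (backward persistence of negativity — `WakeRatchetDyadic.dyadic_nonneg` made
coordinate-free).  With the pivot `x̂ = x − x_i e_i`, `(Q x)_i = (Q x̂)_i + x_i ℓ_Q(x)` and
`(B(z,x))_i = (B(z,x̂))_i + x_i (B(z,e_i))_i` (`tableQ_apply_pivot`, `tableB_apply_pivot`), so
`u = W_{n,i}` obeys `u' = r u + g` with `g = (Q Ŵ_n)_i + Λ(A W_{n-1})_i ≥ 0` and a continuous rate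
`r ≤ 3C₀‖W_n‖ + Λ⁻¹C₁‖W_{n+1}‖` (`C_μ = shiftConst α μ`); the UNIFORM action bound gives
`∫_s^{σ₁} r ≤ (3C₀ + Λ⁻¹C₁)M` for all `s ≤ σ₁`, so `u e^{-∫r}` is non-decreasing and a negative value
`u(σ₁) = −δ` propagates backwards as `u(s) ≤ −δ e^{-(3C₀+Λ⁻¹C₁)M}` for ALL `s ≤ σ₁` — incompatible
with `∫‖W_n‖ < ∞`.  MODEL lattice ODEs only (Tao 2016 §4, §6.4); nothing in this file is a statement
about the Navier–Stokes equations, and no summit or rung is proved by it.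
-/

noncomputable section

set_option linter.dupNamespace false

namespace Summit.NavierStokesRegularity.NavierStokesRegularity.Theorems

namespace WakeRatchetOrthant

open Filter Topology MeasureTheory Set intervalIntegral
open scoped RealInnerProductSpace
open Literature.Analysis.FluidPDE Literature.Analysis.FluidPDE.TaoCascade
open WakeRatchetFedSpike WakeRatchetPersistence WakeRatchetDyadic

section Algebra

variable {m : ℕ}

/-- `qform` is additive in its first vector argument. [cite: Tao2016AveragedNS, §4 (4.1) (the bilinear structure forms); folklore algebra] -/
theorem qform_add_left (α : Fin m → Fin m → Fin m → ℤ × ℤ × ℤ → ℝ) (μ : ℤ × ℤ × ℤ)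
    (y y' x : Em m) (i : Fin m) :
    qform α μ (y + y') x i = qform α μ y x i + qform α μ y' x i := by
  unfold qform
  simp only [PiLp.add_apply, add_mul, mul_add, Finset.sum_add_distrib]

/-- `qform` is additive in its second vector argument. [cite: Tao2016AveragedNS, §4 (4.1); folklore algebra] -/
theorem qform_add_right (α : Fin m → Fin m → Fin m → ℤ × ℤ × ℤ → ℝ) (μ : ℤ × ℤ × ℤ)
    (y x x' : Em m) (i : Fin m) :
    qform α μ y (x + x') i = qform α μ y x i + qform α μ y x' i := by
  unfold qform
  simp only [PiLp.add_apply, mul_add, Finset.sum_add_distrib]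

/-- `qform` is homogeneous in its first vector argument. [cite: Tao2016AveragedNS, §4 (4.1); folklore algebra] -/
theorem qform_smul_left (α : Fin m → Fin m → Fin m → ℤ × ℤ × ℤ → ℝ) (μ : ℤ × ℤ × ℤ) (c : ℝ)
    (y x : Em m) (i : Fin m) :
    qform α μ (c • y) x i = c * qform α μ y x i := by
  unfold qform
  simp only [PiLp.smul_apply, smul_eq_mul, Finset.mul_sum]
  refine Finset.sum_congr rfl fun i₁ _ => Finset.sum_congr rfl fun i₂ _ => ?_
  ring

/-- `qform` is homogeneous in its second vector argument. [cite: Tao2016AveragedNS, §4 (4.1); folklore algebra] -/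
theorem qform_smul_right (α : Fin m → Fin m → Fin m → ℤ × ℤ × ℤ → ℝ) (μ : ℤ × ℤ × ℤ) (c : ℝ)
    (y x : Em m) (i : Fin m) :
    qform α μ y (c • x) i = c * qform α μ y x i := by
  unfold qform
  simp only [PiLp.smul_apply, smul_eq_mul, Finset.mul_sum]
  refine Finset.sum_congr rfl fun i₁ _ => Finset.sum_congr rfl fun i₂ _ => ?_
  ring

/-- `|qform α μ y x i| ≤ shiftConst α μ · ‖y‖‖x‖` (the `ℓ¹` block size of the table at shift `μ`).
[cite: Tao2016AveragedNS, §4 (4.1), Lemma 4.1 (4.8); cell lemma (`shiftConst`)] -/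
theorem abs_qform_le_shiftConst (α : Fin m → Fin m → Fin m → ℤ × ℤ × ℤ → ℝ) (μ : ℤ × ℤ × ℤ)
    (y x : Em m) (i : Fin m) :
    |qform α μ y x i| ≤ shiftConst α μ * (‖y‖ * ‖x‖) := by
  refine (abs_qform_le α μ y x i).trans (mul_le_mul_of_nonneg_right ?_ (by positivity))
  unfold shiftConst
  exact Finset.single_le_sum (f := fun i => ∑ i₁, ∑ i₂, |α i₁ i₂ i μ|)
    (fun j _ => Finset.sum_nonneg fun _ _ => Finset.sum_nonneg fun _ _ => abs_nonneg _)
    (Finset.mem_univ i)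

/-- The coordinate vector `e_i` has norm one. [folklore] -/
theorem norm_single_one (i : Fin m) : ‖(EuclideanSpace.single i (1 : ℝ) : Em m)‖ = 1 := by
  rw [PiLp.norm_single, norm_one]

/-- The PIVOT of a shell vector at mode `i`: `x̂ = x − x_i e_i` (coordinate `i` set to zero).
[folklore] -/
theorem pivot_apply_self (x : Em m) (i : Fin m) :
    (x - x i • (EuclideanSpace.single i (1 : ℝ) : Em m)) i = 0 := by
  simp

/-- `‖x̂‖ ≤ 2‖x‖` for the pivot `x̂ = x − x_i e_i`. [folklore] -/
theorem norm_pivot_le (x : Em m) (i : Fin m) :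
    ‖x - x i • (EuclideanSpace.single i (1 : ℝ) : Em m)‖ ≤ 2 * ‖x‖ := by
  refine (norm_sub_le _ _).trans ?_
  rw [norm_smul, norm_single_one, mul_one, Real.norm_eq_abs, two_mul]
  exact add_le_add le_rfl (abs_apply_le_norm x i)

end Algebra

section Cone

variable {m : ℕ} {ε₀ νh : ℝ} {α : Fin m → Fin m → Fin m → ℤ × ℤ × ℤ → ℝ} {W : ℤ → ℝ → Em m}

/-- **The lattice law componentwise.**  Mode `i` of shell `n` of an admissible eternal solution obeys
`u' = −(1+ν̂_n)u + (Q W_n)_i + Λ (A W_{n-1})_i + Λ⁻¹ (B(W_{n+1}, W_n))_i` in log-time.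
[cite: Tao2016AveragedNS, §4 Lemma 4.1 (iii) (4.8), the viscous equation before Thm. 4.2, §6.4; cell vocabulary (`IsEternalVisc`, `viscCoef`)] -/
theorem hasDerivAt_apply (hW : IsEternalVisc ε₀ νh α W) (n : ℤ) (σ : ℝ) (i : Fin m) :
    HasDerivAt (fun s => W n s i)
      (-(1 + viscCoef ε₀ νh n σ) * W n σ i + tableQ α (W n σ) i
        + bigLam ε₀ * tableA α (W (n - 1) σ) i
        + (bigLam ε₀)⁻¹ * tableB α (W (n + 1) σ) (W n σ) i) σ := by
  have h := (PiLp.proj 2 (𝕜 := ℝ) (fun _ : Fin m => ℝ) i).hasFDerivAt.comp_hasDerivAt σ (hW.law n σ)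
  have e : (PiLp.proj 2 (𝕜 := ℝ) (fun _ : Fin m => ℝ) i)
      (-((1 : ℝ) • W n σ) + tableQ α (W n σ) + bigLam ε₀ • tableA α (W (n - 1) σ)
        + (bigLam ε₀)⁻¹ • tableB α (W (n + 1) σ) (W n σ)
        - (νh * ((1 + ε₀) ^ ((2 : ℝ) * n) * Real.exp (-σ))) • W n σ)
      = -(1 + viscCoef ε₀ νh n σ) * W n σ i + tableQ α (W n σ) i
        + bigLam ε₀ * tableA α (W (n - 1) σ) i
        + (bigLam ε₀)⁻¹ * tableB α (W (n + 1) σ) (W n σ) i := by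
    simp only [PiLp.proj_apply, PiLp.sub_apply, PiLp.add_apply, PiLp.neg_apply, PiLp.smul_apply,
      smul_eq_mul]
    unfold viscCoef
    ring
  rw [e] at h
  exact h

/-- Shells of an admissible eternal solution are continuous in log-time. [cite: Tao2016AveragedNS, §4 Lemma 4.1 (4.8), §6.4; cell vocabulary] -/
theorem continuous_shell (hW : IsEternalVisc ε₀ νh α W) (n : ℤ) : Continuous (W n) :=
  continuous_iff_continuousAt.2 fun x => (hW.law n x).continuousAt

/-- Coordinates of a continuous shell-vector curve are continuous. [folklore] -/
theorem continuous_coord {f : ℝ → Em m} (hf : Continuous f) (j : Fin m) :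
    Continuous fun s => f s j :=
  (PiLp.proj 2 (𝕜 := ℝ) (fun _ : Fin m => ℝ) j).continuous.comp hf

/-- The coordinate forms `qform` are continuous along continuous shell-vector curves.
[cite: Tao2016AveragedNS, §4 (4.1); folklore] -/
theorem continuous_qform {f g : ℝ → Em m} (hf : Continuous f) (hg : Continuous g)
    (α : Fin m → Fin m → Fin m → ℤ × ℤ × ℤ → ℝ) (μ : ℤ × ℤ × ℤ) (i : Fin m) :
    Continuous fun s => qform α μ (f s) (g s) i := by
  unfold qform
  refine continuous_finsetSum _ fun i₁ _ => continuous_finsetSum _ fun i₂ _ => ?_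
  exact continuous_const.mul ((continuous_coord hf i₁).mul (continuous_coord hg i₂))

/-- **Pivot decomposition of the intra-shell component**: with `x̂ = x − x_i e_i`,
`(Q x)_i = (Q x̂)_i + x_i · (qform(x̂, e_i)_i + qform(e_i, x)_i)` — the part of `(Q x)_i` not
carried by the coordinate `x_i` itself is the value of the form at the pivot.
[cite: Tao2016AveragedNS, §4 (4.1), Lemma 4.1 (4.8); folklore algebra] -/
theorem tableQ_apply_pivot (α : Fin m → Fin m → Fin m → ℤ × ℤ × ℤ → ℝ) (x : Em m) (i : Fin m) :
    tableQ α x i = tableQ α (x - x i • (EuclideanSpace.single i (1 : ℝ) : Em m)) i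
      + x i * (qform α (0, 0, 0) (x - x i • (EuclideanSpace.single i (1 : ℝ) : Em m))
          (EuclideanSpace.single i (1 : ℝ)) i
        + qform α (0, 0, 0) (EuclideanSpace.single i (1 : ℝ)) x i) := by
  set e : Em m := EuclideanSpace.single i (1 : ℝ) with he
  rw [tableQ_apply, tableQ_apply]
  calc qform α (0, 0, 0) x x i = qform α (0, 0, 0) (x - x i • e + x i • e) x i := by
        rw [sub_add_cancel]
    _ = qform α (0, 0, 0) (x - x i • e) x i + x i * qform α (0, 0, 0) e x i := by
        rw [qform_add_left, qform_smul_left]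
    _ = qform α (0, 0, 0) (x - x i • e) (x - x i • e + x i • e) i
          + x i * qform α (0, 0, 0) e x i := by rw [sub_add_cancel]
    _ = qform α (0, 0, 0) (x - x i • e) (x - x i • e) i
          + x i * qform α (0, 0, 0) (x - x i • e) e i + x i * qform α (0, 0, 0) e x i := by
        rw [qform_add_right, qform_smul_right]
    _ = _ := by ring

/-- **Pivot decomposition of the back-reaction component**: with `x̂ = x − x_i e_i`,
`(B(z, x))_i = (B(z, x̂))_i + x_i · (B(z, e_i))_i`.
[cite: Tao2016AveragedNS, §4 (4.1), Lemma 4.1 (4.8); folklore algebra] -/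
theorem tableB_apply_pivot (α : Fin m → Fin m → Fin m → ℤ × ℤ × ℤ → ℝ) (z x : Em m) (i : Fin m) :
    tableB α z x i = tableB α z (x - x i • (EuclideanSpace.single i (1 : ℝ) : Em m)) i
      + x i * tableB α z (EuclideanSpace.single i (1 : ℝ)) i := by
  set e : Em m := EuclideanSpace.single i (1 : ℝ) with he
  rw [tableB_apply, tableB_apply, tableB_apply]
  calc qform α (1, 0, 0) z x i + qform α (0, 1, 0) x z i
        = qform α (1, 0, 0) z (x - x i • e + x i • e) i
          + qform α (0, 1, 0) (x - x i • e + x i • e) z i := by rw [sub_add_cancel]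
    _ = _ := by
        rw [qform_add_right, qform_smul_right, qform_add_left, qform_smul_left]
        ring

/-- The covariant viscosity coefficient is non-negative. [cite: Tao2016AveragedNS, §4, the viscous equation before Thm. 4.2; cell vocabulary (`viscCoef`)] -/
theorem viscCoef_nonneg' (hε : 0 < ε₀) (hν : 0 ≤ νh) (n : ℤ) (s : ℝ) : 0 ≤ viscCoef ε₀ νh n s := by
  unfold viscCoef
  have hx : 0 < 1 + ε₀ := by linarith
  exact mul_nonneg hν (mul_nonneg (Real.rpow_nonneg hx.le _) (Real.exp_pos _).le)

/-- **NON-NEGATIVITY ON THE STRONG-ORTHANT CLASS (per mode).**  Let `W` be an admissible eternal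
solution (`IsEternalVisc ε₀ ν̂ α W`, any covariant viscosity `ν̂ ≥ 0`, any `ε₀ > 0`, any table `α` on
any number of modes) and let the mode `i` be STRONGLY QUASI-POSITIVE for `α`: the feed form into `i`
is non-negative on all of `ℝ^m` (`(A y)_i ≥ 0`), the in-shell form into `i` is non-negative on the
hyperplane `{x_i = 0}` (`(Q x)_i ≥ 0` there), and the back-reaction on `i` is diagonal
(`(B(z, x))_i = 0` whenever `x_i = 0`) — the UNCONDITIONAL Kamke condition at mode `i` (no sign
assumption on the other modes or shells; satisfied by every mode of a pure Katz–Pavlović network: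
square feeds `x_s² → x_t` across shells with the energy-conserving damping `−x_s y_t`, and in-shell
pump gates `(Q x)_t = q x_s²`, `(Q x)_s = −q x_s x_t`).  THEN `W_{n,i}(σ) ≥ 0` for every shell and
log-time.  Mechanism (backward persistence of negativity): the pivot decompositions give
`u' = r u + g` for `u = W_{n,i}` with `g = (Q Ŵ_n)_i + Λ (A W_{n-1})_i ≥ 0` and a continuous rate
`r ≤ 3C₀‖W_n‖ + Λ⁻¹C₁‖W_{n+1}‖` whose integral over any past interval is `≤ (3C₀ + Λ⁻¹C₁)·M` by the
UNIFORM action bound; so `u e^{-∫r}` is non-decreasing, a negative value `u(σ₁) = −δ` forces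
`u(s) ≤ −δ e^{-(3C₀+Λ⁻¹C₁)M}` for ALL `s ≤ σ₁`, and `‖W_n‖` is not integrable — contradiction.
(Generalises `WakeRatchetDyadic.dyadic_nonneg` from the dyadic member to the whole class.)
MODEL lattice ODEs only; nothing about the Navier–Stokes equations.
[cite: Tao2016AveragedNS, §1.2 (dyadic Katz–Pavlović model), §4 Lemma 4.1 (4.8) with the cancellation (4.3), the viscous equation before Thm. 4.2, §6.4; cell vocabulary (`IsEternalVisc`, `tableQ`/`tableA`/`tableB`)] -/
theorem apply_nonneg (hε : 0 < ε₀) (hW : IsEternalVisc ε₀ νh α W) (i : Fin m)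
    (hA : ∀ y : Em m, 0 ≤ tableA α y i)
    (hQ : ∀ x : Em m, x i = 0 → 0 ≤ tableQ α x i)
    (hB : ∀ z x : Em m, x i = 0 → tableB α z x i = 0)
    (n : ℤ) (σ₁ : ℝ) : 0 ≤ W n σ₁ i := by
  by_contra hneg
  have hlt0 : W n σ₁ i < 0 := not_le.mp hneg
  set δ : ℝ := -(W n σ₁ i) with hδdef
  have hδ : 0 < δ := by rw [hδdef]; linarith
  obtain ⟨M, hM⟩ := hW.action
  have hM0 : 0 ≤ M := le_trans (integral_nonneg fun _ => norm_nonneg _) (hM 0).2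
  have hΛpos : 0 < bigLam ε₀ := bigLam_pos (by linarith)
  have hΛi : 0 ≤ (bigLam ε₀)⁻¹ := inv_nonneg.2 hΛpos.le
  set e : Em m := EuclideanSpace.single i (1 : ℝ) with hedef
  have he1 : ‖e‖ = 1 := norm_single_one i
  -- the table constants
  set c₀ : ℝ := shiftConst α (0, 0, 0) with hc₀def
  set c₁ : ℝ := shiftConst α (1, 0, 0) + shiftConst α (0, 1, 0) with hc₁def
  have hc₀ : 0 ≤ c₀ := shiftConst_nonneg α _
  have hc₁ : 0 ≤ c₁ := add_nonneg (shiftConst_nonneg α _) (shiftConst_nonneg α _)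
  -- the rate `r` and the source `g` of the scalar law `u' = r u + g`
  set ℓQ : ℝ → ℝ := fun s =>
    qform α (0, 0, 0) (W n s - W n s i • e) e i + qform α (0, 0, 0) e (W n s) i with hℓQdef
  set ℓB : ℝ → ℝ := fun s => tableB α (W (n + 1) s) e i with hℓBdef
  set r : ℝ → ℝ := fun s => -(1 + viscCoef ε₀ νh n s) + ℓQ s + (bigLam ε₀)⁻¹ * ℓB s with hrdef
  set g : ℝ → ℝ := fun s =>
    tableQ α (W n s - W n s i • e) i + bigLam ε₀ * tableA α (W (n - 1) s) i with hgdef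
  have hg : ∀ s, 0 ≤ g s := fun s =>
    add_nonneg (hQ _ (pivot_apply_self (W n s) i)) (mul_nonneg hΛpos.le (hA _))
  have hu : ∀ s, HasDerivAt (fun s => W n s i) (r s * W n s i + g s) s := by
    intro s
    refine (hasDerivAt_apply hW n s i).congr_deriv ?_
    rw [tableQ_apply_pivot α (W n s) i, tableB_apply_pivot α (W (n + 1) s) (W n s) i,
      hB _ _ (pivot_apply_self (W n s) i)]
    simp only [hrdef, hgdef, hℓQdef, hℓBdef, hedef]
    ring
  -- continuity of the rate
  have hWc : ∀ k : ℤ, Continuous (W k) := continuous_shell hW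
  have hui : Continuous fun s => W n s i := continuous_coord (hWc n) i
  have hpc : Continuous fun s => W n s - W n s i • e := (hWc n).sub (hui.smul continuous_const)
  have hr : Continuous r := by
    have hv : Continuous fun s => viscCoef ε₀ νh n s := by
      unfold viscCoef
      fun_prop
    have h1 : Continuous ℓQ :=
      (continuous_qform hpc continuous_const α (0, 0, 0) i).add
        (continuous_qform continuous_const (hWc n) α (0, 0, 0) i)
    have h2 : Continuous ℓB := by
      have eB : ℓB = fun s => qform α (1, 0, 0) (W (n + 1) s) e i + qform α (0, 1, 0) e (W (n + 1) s) i :=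
        funext fun s => tableB_apply α _ _ i
      rw [eB]
      exact (continuous_qform (hWc (n + 1)) continuous_const α (1, 0, 0) i).add
        (continuous_qform continuous_const (hWc (n + 1)) α (0, 1, 0) i)
    simp only [hrdef]
    exact ((continuous_const.add hv).neg.add h1).add (continuous_const.mul h2)
  -- the rate is bounded by the actions of shells `n` and `n+1`
  have hr_le : ∀ s, r s ≤ 3 * c₀ * ‖W n s‖ + (bigLam ε₀)⁻¹ * c₁ * ‖W (n + 1) s‖ := by
    intro s
    have hv0 : 0 ≤ viscCoef ε₀ νh n s := viscCoef_nonneg' hε hW.nonneg n s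
    have h1 : |ℓQ s| ≤ 3 * c₀ * ‖W n s‖ := by
      have ha := abs_qform_le_shiftConst α (0, 0, 0) (W n s - W n s i • e) e i
      have hb := abs_qform_le_shiftConst α (0, 0, 0) e (W n s) i
      rw [he1, mul_one] at ha
      rw [he1, one_mul] at hb
      have hp : ‖W n s - W n s i • e‖ ≤ 2 * ‖W n s‖ := norm_pivot_le (W n s) i
      calc |ℓQ s| ≤ |qform α (0, 0, 0) (W n s - W n s i • e) e i| + |qform α (0, 0, 0) e (W n s) i| :=
            abs_add_le _ _
        _ ≤ c₀ * (2 * ‖W n s‖) + c₀ * ‖W n s‖ :=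
            add_le_add (ha.trans (mul_le_mul_of_nonneg_left hp hc₀)) hb
        _ = 3 * c₀ * ‖W n s‖ := by ring
    have h2 : |ℓB s| ≤ c₁ * ‖W (n + 1) s‖ := by
      have ha := abs_qform_le_shiftConst α (1, 0, 0) (W (n + 1) s) e i
      have hb := abs_qform_le_shiftConst α (0, 1, 0) e (W (n + 1) s) i
      rw [he1, mul_one] at ha
      rw [he1, one_mul] at hb
      have eB : ℓB s = qform α (1, 0, 0) (W (n + 1) s) e i + qform α (0, 1, 0) e (W (n + 1) s) i :=
        tableB_apply α _ _ i
      rw [eB]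
      calc |qform α (1, 0, 0) (W (n + 1) s) e i + qform α (0, 1, 0) e (W (n + 1) s) i|
            ≤ |qform α (1, 0, 0) (W (n + 1) s) e i| + |qform α (0, 1, 0) e (W (n + 1) s) i| :=
            abs_add_le _ _
        _ ≤ shiftConst α (1, 0, 0) * ‖W (n + 1) s‖ + shiftConst α (0, 1, 0) * ‖W (n + 1) s‖ :=
            add_le_add ha hb
        _ = c₁ * ‖W (n + 1) s‖ := by rw [hc₁def]; ring
    have h3 : ℓQ s ≤ 3 * c₀ * ‖W n s‖ := (le_abs_self _).trans h1
    have h4 : (bigLam ε₀)⁻¹ * ℓB s ≤ (bigLam ε₀)⁻¹ * c₁ * ‖W (n + 1) s‖ := by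
      rw [mul_assoc]
      exact mul_le_mul_of_nonneg_left ((le_abs_self _).trans h2) hΛi
    have h5 : -(1 + viscCoef ε₀ νh n s) ≤ 0 := by linarith
    show -(1 + viscCoef ε₀ νh n s) + ℓQ s + (bigLam ε₀)⁻¹ * ℓB s ≤ _
    linarith
  -- the integrating factor `exp(-R)`, `R(s) = ∫_{σ₁}^{s} r`
  set R : ℝ → ℝ := fun s => ∫ t in σ₁..s, r t with hRdef
  have hR : ∀ s, HasDerivAt R (r s) s := fun s =>
    intervalIntegral.integral_hasDerivAt_right (hr.intervalIntegrable _ _)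
      (hr.stronglyMeasurableAtFilter _ _) hr.continuousAt
  set Rmax : ℝ := 3 * c₀ * M + (bigLam ε₀)⁻¹ * c₁ * M with hRmaxdef
  have hRbd : ∀ s, s ≤ σ₁ → -Rmax ≤ R s := by
    intro s hs
    have e1 : R s = -∫ t in s..σ₁, r t := by
      simp only [hRdef]; rw [intervalIntegral.integral_symm]
    rw [e1, neg_le_neg_iff]
    have hbc : Continuous fun t => 3 * c₀ * ‖W n t‖ + (bigLam ε₀)⁻¹ * c₁ * ‖W (n + 1) t‖ :=
      (continuous_const.mul (hWc n).norm).add (continuous_const.mul (hWc (n + 1)).norm)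
    have hmono : ∫ t in s..σ₁, r t ≤ ∫ t in s..σ₁, (3 * c₀ * ‖W n t‖ + (bigLam ε₀)⁻¹ * c₁ * ‖W (n + 1) t‖) :=
      intervalIntegral.integral_mono_on hs (hr.intervalIntegrable _ _) (hbc.intervalIntegrable _ _)
        fun t _ => hr_le t
    have hsplit : ∫ t in s..σ₁, (3 * c₀ * ‖W n t‖ + (bigLam ε₀)⁻¹ * c₁ * ‖W (n + 1) t‖)
        = (3 * c₀ * ∫ t in s..σ₁, ‖W n t‖) + (bigLam ε₀)⁻¹ * c₁ * ∫ t in s..σ₁, ‖W (n + 1) t‖ := by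
      rw [intervalIntegral.integral_add ((hWc n).norm.intervalIntegrable _ _ |>.const_mul _)
        ((hWc (n + 1)).norm.intervalIntegrable _ _ |>.const_mul _),
        intervalIntegral.integral_const_mul, intervalIntegral.integral_const_mul]
    have hIn : ∫ t in s..σ₁, ‖W n t‖ ≤ M :=
      (intervalIntegral_le_integral (hM n).1 (fun _ => norm_nonneg _) hs).trans (hM n).2
    have hIn1 : ∫ t in s..σ₁, ‖W (n + 1) t‖ ≤ M :=
      (intervalIntegral_le_integral (hM (n + 1)).1 (fun _ => norm_nonneg _) hs).trans (hM (n + 1)).2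
    have h3c : 0 ≤ 3 * c₀ := by positivity
    have hΛc : 0 ≤ (bigLam ε₀)⁻¹ * c₁ := mul_nonneg hΛi hc₁
    calc ∫ t in s..σ₁, r t
        ≤ (3 * c₀ * ∫ t in s..σ₁, ‖W n t‖) + (bigLam ε₀)⁻¹ * c₁ * ∫ t in s..σ₁, ‖W (n + 1) t‖ :=
          hmono.trans_eq hsplit
      _ ≤ 3 * c₀ * M + (bigLam ε₀)⁻¹ * c₁ * M :=
          add_le_add (mul_le_mul_of_nonneg_left hIn h3c) (mul_le_mul_of_nonneg_left hIn1 hΛc)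
  -- `φ = u · exp(-R)` is non-decreasing (its derivative is `exp(-R) g ≥ 0`)
  set φ : ℝ → ℝ := fun s => W n s i * Real.exp (-R s) with hφdef
  have hφd : ∀ s, HasDerivAt φ (Real.exp (-R s) * g s) s := by
    intro s
    have h3 : HasDerivAt (fun x => Real.exp (-R x)) (Real.exp (-R s) * (-r s)) s := (hR s).neg.exp
    have := (hu s).mul h3
    exact this.congr_deriv (by ring)
  have hφmono : Monotone φ := by
    refine monotone_of_deriv_nonneg (fun s => (hφd s).differentiableAt) fun s => ?_
    rw [(hφd s).deriv]
    exact mul_nonneg (Real.exp_pos _).le (hg s)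
  -- backward propagation of negativity
  have hback : ∀ s, s ≤ σ₁ → δ * Real.exp (-Rmax) ≤ ‖W n s‖ := by
    intro s hs
    have h1 : φ s ≤ φ σ₁ := hφmono hs
    have hRσ₁ : R σ₁ = 0 := by simp only [hRdef, intervalIntegral.integral_same]
    have eφ1 : φ σ₁ = -δ := by
      simp only [hφdef, hRσ₁, neg_zero, Real.exp_zero, mul_one, hδdef, neg_neg]
    have hE : 0 < Real.exp (-R s) := Real.exp_pos _
    have hus : W n s i ≤ -δ * Real.exp (R s) := by
      have h2 : W n s i * Real.exp (-R s) ≤ -δ := by rw [← eφ1]; exact h1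
      have h3 : -δ = (-δ * Real.exp (R s)) * Real.exp (-R s) := by
        rw [mul_assoc, ← Real.exp_add, add_neg_cancel, Real.exp_zero, mul_one]
      rw [h3] at h2
      exact le_of_mul_le_mul_right h2 hE
    have hexp : Real.exp (-Rmax) ≤ Real.exp (R s) := Real.exp_le_exp.2 (hRbd s hs)
    have hus' : W n s i ≤ -(δ * Real.exp (-Rmax)) := by
      have := mul_le_mul_of_nonneg_left hexp hδ.le
      linarith
    have hpos : 0 ≤ δ * Real.exp (-Rmax) := by positivity
    have habs : δ * Real.exp (-Rmax) ≤ |W n s i| := by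
      rw [abs_of_nonpos (by linarith)]
      linarith
    exact habs.trans (abs_apply_le_norm (W n s) i)
  -- contradiction with the integrability of `‖W_n‖`
  have hη : 0 < δ * Real.exp (-Rmax) := by positivity
  obtain ⟨a, ha, hlt⟩ := exists_le_abs_lt (hM n).1 hη σ₁
  rw [abs_of_nonneg (norm_nonneg _)] at hlt
  exact absurd (hback a ha) (not_le.2 hlt)

end Cone

end WakeRatchetOrthant

end Summit.NavierStokesRegularity.NavierStokesRegularity.Theorems

end
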